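import Summits.AtomisticToContinuum.Crystallization.Theorems.FrustratedLawDichotomyCollarCensusZeroFree
import Literature.Barriers.AtomisticToContinuum.LocalizedPotentialsExcludeLennardJones

/-!
# The strained-patch piece `F1X∪T(0)` of the 27623 zero-tolerance tight-collar line: HOMOGENEOUS FLOOR ∧ TEXTURE RELIEF

Lens-5 g43 node «LinearResponse» (critic rows 674 (a), 711 (4)).  The strained-patch piece of
`…CollarCensusZeroFree.aperiodicFrustratedLawGap_of_collarPiecesKK_milli_unionT_zero_free` (hypothesis `h1`) is

  `F1X∪T(0) = StrainedPatchMotifPricingCapXK (1/1000) (9/5) (133/10) (3/2) W₄₅ e_W ExRec`: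

for every injective `7/10`-separated cluster inside a `133/10`-ball whose `9/5`-ball around the centre has no `1/20`-good site, no
`1/8`-bad site and no exempt site within `9/2` (exempt = one-atom-move/removal unstable at move tolerance `0`, or `1/20`-good at fit scale
`≤ 3/2`), the sender-normalised ball average of the capped surplus `x_j = ½(Σ_k W₄₅(r_jk) − W₄₅ 0) − e_W − κ_T·𝟙[¬Good(1/8)]` is `≥ 0`.

THE SPLIT (by content, not a weakening — see the honesty paragraph):
* `HomFloor m` **[INSTRUMENTABLE]** — the piece's functional is `≥ m` on the HOMOGENEOUS instances: clusters whose point set is the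
  `133/10`-ball of an affinely deformed fcc lattice (`‖G − 1‖ ≤ 1/4`) or of an affinely deformed hcp structure with an internal shuffle
  (`‖ξ‖ ≤ 1/4`), subject to exactly the piece's hypotheses: `≤ 9` reals modulo rotations, decidable by interval branch-and-bound.
  Float optimum (`hz42.py`/`fz43.py`): `m_H = 2.075e-3` (hcp, basal shear `e_yz = .0254` + relaxed `E2g` shuffle, ON the `η = 1/20` boundary);
  fcc floor `3.398e-3`; with the shuffle riding the force cap `σ₁` instead of relaxed: `2.010e-3`.  Claim to certify: `HomFloor (1/625)` (`1.6e-3`,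
  `20 %` below the force-capped float floor; the force cap is essential, see §3).
* `TextureReliefBound L B` **[ANALYTIC residual; UNDECIDED]** — every admissible cluster is within `L·σ₁ + B` of SOME admissible
  homogeneous instance: `ballAvg z ≥ ballAvg z₀ − (L·σ₁ + B)`, `σ₁ = S₇♯(7) = 0.010798…` = the `s → 0` per-site force cap of
  `MoveUnstableCore 0 7 s` (`sigmaOne`).  Measured (family A = the float minimiser, all 1616 reach sites held `1/20`-bad, exterior free):
  relief `m_H − S_c(0) = 2.075e-3 − 1.822e-3 = 2.5e-4`, LINEAR in the cap over a factor 9 of caps (`L = .022 ± .001`); every other family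
  (fcc, torsion, helicoid, laminate, dimerised, annulus piles) ends ABOVE `m_H`.  Claim: `TextureReliefBound (1/12) (1/4000)`
  (allowance `L·σ₁ + B = 1.15e-3 = 4.5×` the measured relief).
* seam **[PROVED, `strainedPatch_of_homFloor_of_relief`]**: `HomFloor m → TextureReliefBound L B → L·σ₁ + B ≤ m → F1X∪T(0)`;
  arithmetic of record `1/12·σ₁ + 1/4000 ≤ 1/625` (`0.000900 + 0.000250 ≤ 0.0016`) is `seam_arith`.
* necessity **[PROVED]**: `F1X∪T(0) → HomFloor 0` (`homFloor_zero_of_strainedPatch`), and `F1X∪T(0) ∧ (an admissible homogeneous instance of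
  value ≤ L·σ₁ + B) → TextureReliefBound L B` (`relief_of_strainedPatch_of_witness`): (R) strengthens the piece EXACTLY by the margin below the floor.

HONESTY.  Given `HomFloor m` with `m ≥ L·σ₁ + B`, `TextureReliefBound L B` implies the piece and is not weaker than it; the split isolates what
certified numerics settle (WHICH number, 9 variables) from the one rigidity statement (force-capped textures relieve at most `O(σ₁)`).  WHY NOVEL:
no prior node prices the all-`5 %`-misfit aperiodic texture; the measured linear response law `relief = L·cap` makes an allowance of order `σ₁`
the right residual.  Evidence: `run/shared/lean/pub/decomp-a2c/decomp-a2c-lens-5/g43/{NODE-g43.md, ENV-g43.md, GATE-g43.md, state/, check/}`.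
-/

namespace Summit.AtomisticToContinuum.Crystallization.Theorems.FrustratedLawDichotomyStrainedPatchHomSplit

open scoped BigOperators Classical
open Summit.AtomisticToContinuum.Crystallization.Theorems.FrustratedLawDichotomyRangeCut
open Summit.AtomisticToContinuum.Crystallization.Theorems.FrustratedLawDichotomySchurCut
open Summit.AtomisticToContinuum.Crystallization.Theorems.FrustratedLawDichotomyMotifLemmas
open Summit.AtomisticToContinuum.Crystallization.Theorems.FrustratedLawDichotomyAveragingCut
open Summit.AtomisticToContinuum.Crystallization.Theorems.FrustratedLawDichotomyAveragingRuleCap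
open Summit.AtomisticToContinuum.Crystallization.Theorems.FrustratedLawDichotomyAveragingRuleTightFree
open Summit.AtomisticToContinuum.Crystallization.Theorems.FrustratedLawDichotomyExemptDoor (SitePred)
open Summit.AtomisticToContinuum.Crystallization.Theorems.FrustratedLawDichotomyExemptAbsorption
open Summit.AtomisticToContinuum.Crystallization.Theorems.FrustratedLawDichotomyExemptAbsorptionRecord
open Summit.AtomisticToContinuum.Crystallization.Theorems.FrustratedLawDichotomyCollarCensus
open Summit.AtomisticToContinuum.Crystallization.Theorems.FrustratedLawDichotomyCollarCensusKappa

local notation "ℝ³" => EuclideanSpace ℝ (Fin 3)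

/-! ## §1. The record data of the strained-patch piece -/

/-- The exemption of record at T-side move tolerance `0`: within `9/2`, a one-atom-move/removal-unstable site (`R_m = 7`, `t = 10⁻⁴`)
or a `1/20`-good site at fit scale `≤ 3/2`. -/
def ExRec : SitePred :=
  Collar (9 / 2) fun N y j => (∃ s : ℝ, 0 ≤ s ∧ s ≤ 3 / 2 ∧ NonEquilibriumCore (-(7175 / 10000)) 0 7 s (1 / 10000) N y j) ∨
    GoodAtScale (1 / 20) (3 / 2) y j

/-- The capped surplus of record `x_j` (`κ_T = 1/1000`, `C_T = 0`, potential `W₄₅ = effPot w₄₅ ω₄ (3/400)`, level `e_W = −0.7175 + 3/400`). -/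
noncomputable def xRec (M : ℕ) (z : Fin M → ℝ³) : Fin M → ℝ :=
  surplusCap (1 / 20) (1 / 8) (3 / 2) (effPot w₄₅ ω₄ (3 / 400)) (-(7175 / 10000) + 3 / 400) (1 / 1000) 0 M z

/-- **The piece's hypotheses at centre `c`** (injective, separated, inside the `133/10`-ball, no tight / exempt / bad site near `c`). -/
def Admissible (M : ℕ) (z : Fin M → ℝ³) (c : Fin M) : Prop :=
  Function.Injective z ∧ Sep z ∧ (∀ a : Fin M, dist (z a) (z c) ≤ 133 / 10) ∧
    ¬TightNearCap (9 / 5) (3 / 2) z c ∧ ¬ExemptNear (9 / 5) ExRec z c ∧ ¬BadNearCap (9 / 5) (3 / 2) z c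

/-- `F1X∪T(0)` restated through `Admissible`/`xRec` (literally the `h1` hypothesis of `…ZeroFree.…_unionT_zero_free`, see `strainedPatch_iff`). -/
def StrainedPatchRec : Prop := ∀ (M : ℕ) (z : Fin M → ℝ³) (c : Fin M), Admissible M z c → 0 ≤ ballAvg (9 / 5) z (xRec M z) c

/-- `StrainedPatchRec` IS the record piece. [formal bookkeeping] -/
theorem strainedPatch_iff :
    StrainedPatchRec ↔ StrainedPatchMotifPricingCapXK (1 / 1000) (9 / 5) (133 / 10) (3 / 2) (effPot w₄₅ ω₄ (3 / 400)) (-(7175 / 10000) + 3 / 400)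
      (Collar (9 / 2) fun N y j => (∃ s : ℝ, 0 ≤ s ∧ s ≤ 3 / 2 ∧ NonEquilibriumCore (-(7175 / 10000)) 0 7 s (1 / 10000) N y j) ∨
        GoodAtScale (1 / 20) (3 / 2) y j) := by
  constructor
  · intro h M z hz hs c hb hT hE hB
    exact h M z c ⟨hz, hs, hb, hT, hE, hB⟩
  · rintro h M z c ⟨hz, hs, hb, hT, hE, hB⟩
    exact h M z hz hs c hb hT hE hB

/-! ## §2. Homogeneous instances and the two halves -/


/-- The hexagonal frame of ideal hcp (`a = 1`, `c = √(8/3)`): `(1,0,0), (1/2,√3/2,0), (0,0,√(8/3))`. -/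
noncomputable def hexFrame : Fin 3 → ℝ³ :=
  ![!₂[1, 0, 0], !₂[1 / 2, Real.sqrt 3 / 2, 0], !₂[0, 0, Real.sqrt (8 / 3)]]

/-- The ideal hcp B-layer offset `(u₁ + u₂)/3 + (c/2)·e₃ = (1/2, √3/6, √(2/3))`. -/
noncomputable def hcpShift : ℝ³ := !₂[1 / 2, Real.sqrt 3 / 6, Real.sqrt (2 / 3)]

/-- Deformed lattice point `G(Σ aᵢ fᵢ)`. -/
def latPt (G : ℝ³ →L[ℝ] ℝ³) (f : Fin 3 → ℝ³) (a : Fin 3 → ℤ) : ℝ³ := G (∑ i : Fin 3, ((a i : ℤ) : ℝ) • f i)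

/-- **Homogeneous ball**: the cluster's point set is exactly the part within `R` of the centre of an affinely deformed fcc lattice through
the centre (`‖G − 1‖ ≤ 1/4`), or of an affinely deformed hcp structure (hexagonal lattice ∪ its translate by `G(hcpShift + ξ)`, `‖ξ‖ ≤ 1/4`). -/
def IsHomBall (R : ℝ) {M : ℕ} (z : Fin M → ℝ³) (c : Fin M) : Prop :=
  ∃ (G : ℝ³ →L[ℝ] ℝ³) (ξ : ℝ³), ‖G - 1‖ ≤ 1 / 4 ∧ ‖ξ‖ ≤ 1 / 4 ∧
    (Set.range z = {x | dist x (z c) ≤ R ∧ ∃ a : Fin 3 → ℤ, x = z c + latPt G Literature.Barriers.AtomisticToContinuum.FlatleyTheil2015.fccVec a} ∨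
      Set.range z = {x | dist x (z c) ≤ R ∧ ∃ a : Fin 3 → ℤ, x = z c + latPt G hexFrame a ∨ x = z c + latPt G hexFrame a + G (hcpShift + ξ)})

/-- **(H) `HomFloor m` [INSTRUMENTABLE]** — the piece's ball average is `≥ m` on every ADMISSIBLE HOMOGENEOUS instance. -/
def HomFloor (m : ℝ) : Prop :=
  ∀ (M : ℕ) (z : Fin M → ℝ³) (c : Fin M), Admissible M z c → IsHomBall (133 / 10) z c → m ≤ ballAvg (9 / 5) z (xRec M z) c

/-- `σ₁ = S₇♯(7) = 6000/343·7⁻⁴ + 2880/49·7⁻⁵ + 10/7·7⁻⁶ + 2·7⁻⁷ ≈ 0.010798`: the `s → 0` slope of the move slack of `MoveUnstableCore 0 7 s`,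
i.e. the per-site force cap every non-exempt reach site obeys at move tolerance `0`; exactly `8892/7⁷`. -/
noncomputable def sigmaOne : ℝ :=
  6000 / 343 * (7 : ℝ)⁻¹ ^ 4 + 2880 / 49 * (7 : ℝ)⁻¹ ^ 5 + 10 / 7 * (7 : ℝ)⁻¹ ^ 6 + 2 * (7 : ℝ)⁻¹ ^ 7

/-- **(R) `TextureReliefBound L B` [ANALYTIC residual]** — every admissible cluster is within `L·σ₁ + B` of SOME admissible homogeneous
instance: force-capped textures (`|F| ≤ σ₁` on the reach) relieve the homogeneous floor by at most `L·σ₁`, exterior freedom by at most `B`. -/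
def TextureReliefBound (L B : ℝ) : Prop :=
  ∀ (M : ℕ) (z : Fin M → ℝ³) (c : Fin M), Admissible M z c →
    ∃ (M₀ : ℕ) (z₀ : Fin M₀ → ℝ³) (c₀ : Fin M₀), Admissible M₀ z₀ c₀ ∧ IsHomBall (133 / 10) z₀ c₀ ∧
      ballAvg (9 / 5) z₀ (xRec M₀ z₀) c₀ - (L * sigmaOne + B) ≤ ballAvg (9 / 5) z (xRec M z) c

/-! ## §3. Seam, necessity, monotonicity, arithmetic of record -/

/-- ★ **SEAM**: `HomFloor m ∧ TextureReliefBound L B ∧ L·σ₁ + B ≤ m ⟹ F1X∪T(0)`. [folklore: three lines] -/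
theorem strainedPatchRec_of_homFloor_of_relief {m L B : ℝ} (hH : HomFloor m) (hR : TextureReliefBound L B)
    (hm : L * sigmaOne + B ≤ m) : StrainedPatchRec := by
  intro M z c hz
  obtain ⟨M₀, z₀, c₀, h₀, hhom, hle⟩ := hR M z c hz
  have hfloor := hH M₀ z₀ c₀ h₀ hhom
  linarith

/-- ★ **SEAM, record form**: the `h1` hypothesis of `…ZeroFree.…_unionT_zero_free` from the two halves. -/
theorem strainedPatch_of_homFloor_of_relief {m L B : ℝ} (hH : HomFloor m) (hR : TextureReliefBound L B) (hm : L * sigmaOne + B ≤ m) :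
    StrainedPatchMotifPricingCapXK (1 / 1000) (9 / 5) (133 / 10) (3 / 2) (effPot w₄₅ ω₄ (3 / 400)) (-(7175 / 10000) + 3 / 400)
      (Collar (9 / 2) fun N y j => (∃ s : ℝ, 0 ≤ s ∧ s ≤ 3 / 2 ∧ NonEquilibriumCore (-(7175 / 10000)) 0 7 s (1 / 10000) N y j) ∨
        GoodAtScale (1 / 20) (3 / 2) y j) :=
  strainedPatch_iff.1 (strainedPatchRec_of_homFloor_of_relief hH hR hm)

/-- ★ **NECESSITY of (H) at level 0**: the piece restricted to homogeneous instances. [folklore] -/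
theorem homFloor_zero_of_strainedPatch
    (h : StrainedPatchMotifPricingCapXK (1 / 1000) (9 / 5) (133 / 10) (3 / 2) (effPot w₄₅ ω₄ (3 / 400)) (-(7175 / 10000) + 3 / 400)
      (Collar (9 / 2) fun N y j => (∃ s : ℝ, 0 ≤ s ∧ s ≤ 3 / 2 ∧ NonEquilibriumCore (-(7175 / 10000)) 0 7 s (1 / 10000) N y j) ∨
        GoodAtScale (1 / 20) (3 / 2) y j)) :
    HomFloor 0 :=
  fun M z c hz _ => strainedPatch_iff.2 h M z c hz

/-- **Where (R) sits**: the piece together with ONE admissible homogeneous instance of value `≤ L·σ₁ + B` gives `TextureReliefBound L B`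
— so (R) strengthens the piece exactly by the margin `m_H − (L·σ₁ + B)` below the homogeneous floor (float: `2.075e-3 − 1.15e-3`). [folklore] -/
theorem relief_of_strainedPatch_of_witness {L B : ℝ} (h : StrainedPatchRec) {M₀ : ℕ} {z₀ : Fin M₀ → ℝ³} {c₀ : Fin M₀}
    (h₀ : Admissible M₀ z₀ c₀) (hhom : IsHomBall (133 / 10) z₀ c₀) (hval : ballAvg (9 / 5) z₀ (xRec M₀ z₀) c₀ ≤ L * sigmaOne + B) :
    TextureReliefBound L B :=
  fun M z c hz => ⟨M₀, z₀, c₀, h₀, hhom, by have := h M z c hz; linarith⟩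

/-- (H) is antitone in the floor. [folklore] -/
theorem HomFloor.mono {m m' : ℝ} (h : HomFloor m) (hle : m' ≤ m) : HomFloor m' :=
  fun M z c hz hhom => hle.trans (h M z c hz hhom)

/-- (R) is monotone in the allowance. [folklore] -/
theorem TextureReliefBound.mono {L B L' B' : ℝ} (h : TextureReliefBound L B) (hle : L * sigmaOne + B ≤ L' * sigmaOne + B') :
    TextureReliefBound L' B' := by
  intro M z c hz
  obtain ⟨M₀, z₀, c₀, h₀, hhom, hval⟩ := h M z c hz
  exact ⟨M₀, z₀, c₀, h₀, hhom, by linarith⟩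

/-- `0.010797 < σ₁ < 0.0108` (`σ₁ = 8892/7⁷ = 0.0107973…`). [arithmetic] -/
theorem sigmaOne_lt : sigmaOne < 108 / 10000 := by unfold sigmaOne; norm_num
/-- `0.010797 < σ₁`. [arithmetic] -/
theorem lt_sigmaOne : 10797 / 1000000 < sigmaOne := by unfold sigmaOne; norm_num

/-- ★ **Seam arithmetic of record**: `(1/12)·σ₁ + 1/4000 ≤ 1/625` (`0.000900 + 0.000250 ≤ 0.001600`, slack `4.5e-4`). [arithmetic] -/
theorem seam_arith : 1 / 12 * sigmaOne + 1 / 4000 ≤ 1 / 625 := by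
  have := sigmaOne_lt; linarith

/-- ★★ **THE NODE (record literals)**: `HomFloor (1/625) ∧ TextureReliefBound (1/12) (1/4000) ⟹ F1X∪T(0)`.  Certifying `HomFloor (1/625)`
MUST use the force cap carried by `¬ExemptNear` (`|F| ≤ σ₁` per site; float floor `2.010e-3`, cap-riding shuffle): WITHOUT it the homogeneous
floor drops to `≈ 1.06e-3 < 1/625` (non-equilibrated shuffle, `|F| ≈ 0.2`; `hzfree43.py`, 9 starts) — the milli variant below trades floor margin
(`50 %`) against relief allowance (`3.7×` measured). -/
theorem strainedPatch_of_homFloor_625_of_relief (hH : HomFloor (1 / 625)) (hR : TextureReliefBound (1 / 12) (1 / 4000)) :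
    StrainedPatchMotifPricingCapXK (1 / 1000) (9 / 5) (133 / 10) (3 / 2) (effPot w₄₅ ω₄ (3 / 400)) (-(7175 / 10000) + 3 / 400)
      (Collar (9 / 2) fun N y j => (∃ s : ℝ, 0 ≤ s ∧ s ≤ 3 / 2 ∧ NonEquilibriumCore (-(7175 / 10000)) 0 7 s (1 / 10000) N y j) ∨
        GoodAtScale (1 / 20) (3 / 2) y j) :=
  strainedPatch_of_homFloor_of_relief hH hR seam_arith

/-- Seam arithmetic, milli variant: `(1/16)·σ₁ + 1/4000 ≤ 1/1000` (`0.000675 + 0.000250 ≤ 0.001`). [arithmetic] -/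
theorem seam_arith_milli : 1 / 16 * sigmaOne + 1 / 4000 ≤ 1 / 1000 := by
  have := sigmaOne_lt; linarith

/-- ★ **THE NODE, milli variant**: `HomFloor (1/1000) ∧ TextureReliefBound (1/16) (1/4000) ⟹ F1X∪T(0)` (floor margin `50 %` of the force-capped
float floor `2.010e-3`; allowance `9.25e-4 = 3.7×` the measured relief `2.5e-4`). -/
theorem strainedPatch_of_homFloor_milli_of_relief (hH : HomFloor (1 / 1000)) (hR : TextureReliefBound (1 / 16) (1 / 4000)) :
    StrainedPatchMotifPricingCapXK (1 / 1000) (9 / 5) (133 / 10) (3 / 2) (effPot w₄₅ ω₄ (3 / 400)) (-(7175 / 10000) + 3 / 400)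
      (Collar (9 / 2) fun N y j => (∃ s : ℝ, 0 ≤ s ∧ s ≤ 3 / 2 ∧ NonEquilibriumCore (-(7175 / 10000)) 0 7 s (1 / 10000) N y j) ∨
        GoodAtScale (1 / 20) (3 / 2) y j) :=
  strainedPatch_of_homFloor_of_relief hH hR seam_arith_milli

end Summit.AtomisticToContinuum.Crystallization.Theorems.FrustratedLawDichotomyStrainedPatchHomSplit
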